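import Literature.NumberTheory.Automorphic.HilbertRepIsotypicComponent
import HarnessLib

/-!
# Matrix coefficients of an irreducible unitary representation do not vanish identically
(Deitmar–Echterhoff, *Principles of Harmonic Analysis* (2014), §6.1: cyclic vectors — "a representation
is irreducible if and only if every nonzero vector is cyclic", PDF p. 175, before Lemma 6.1.7)

Topic `NumberTheory/Automorphic`; theorems only (one auxiliary definition), no named fact, no
instance, over the vocabulary of `HilbertRepSpectrum` (`ClosedSubrep`, `IsTopIrreducible`,
`IsUnitary`) for a representation `π` of a group `G` on a complex Hilbert space `H`. The
*matrix coefficient* of two vectors is the function `g ↦ ⟪π g u, u'⟫`.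

* `ClosedSubrep.inner_apply_eq_zero_of_mem_orthogonal` — **orthogonal invariant pieces never
  pair**: if `u` lies in a closed subrepresentation `W` and `u' ∈ Wᗮ` then `⟪π g u, u'⟫ = 0` for
  every `g` (and the mirror form for unitary `π`).
* `ClosedSubrep.coefficientAnnihilator π u'` — the closed subrepresentation
  `{v | ∀ g, ⟪π g v, u'⟫ = 0}` of vectors all of whose translates are orthogonal to `u'`.
* `ClosedSubrep.exists_inner_apply_ne_zero` — **the matrix coefficients of a topologically
  irreducible closed subrepresentation `W` do not vanish identically**: for non-zero `u, u' ∈ W`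
  some `⟪π g u, u'⟫ ≠ 0`. Proof: otherwise `u` lies in the closed subrepresentation
  `W ∩ coefficientAnnihilator u'`, which is non-zero, hence all of `W` by irreducibility
  (`ClosedSubrep.isTopIrreducible_toContRep_iff`), so `u'` annihilates itself. This is the
  statement "every non-zero vector of an irreducible representation is cyclic" of
  Deitmar–Echterhoff §6.1 read through `u' ⊥ span π(G) u`.
* Unitary complements: `IsUnitary.inner_apply_apply` (`⟪π g u, π g' u'⟫ = ⟪π (g'⁻¹ g) u, u'⟫`),
  the two-sided form `ClosedSubrep.exists_inner_apply_apply_ne_zero`, invariance of the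
  coefficient under the stabilisers of `u` (right) and, for unitary `π`, of `u'` (left), hence
  constancy on double cosets `Stab(u') g Stab(u)` (`inner_apply_doubleCoset_eq`).
* Where the non-vanishing `g` can be taken: in a dense subset when the orbit map of `u` is
  continuous (`exists_mem_inner_apply_ne_zero_of_dense`, the set `{g | ⟪π g u, u'⟫ ≠ 0}` being
  open), among coset representatives `G = Λ · Stab(u)` (`…_of_coset`), and among double-coset
  representatives `G = Stab(u') · Λ · Stab(u)` for unitary `π` (`…_of_doubleCoset`) — no topology
  in the last two.
* `exists_inner_apply_ne_zero_of_isTopIrreducible_isotypicComponent` — the multiplicity-one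
  packaging: if the `σ`-isotypic component (`HilbertRepIsotypicComponent`) is itself irreducible,
  any two non-zero vectors of it pair under some translate; whereas two orthogonal members of a
  class never pair (first bullet), so at multiplicity `≥ 2` the conclusion fails.

## Mathlib

`Submodule.inner_right_of_mem_orthogonal`, `Submodule.mem_orthogonal_singleton_iff_inner_left`,
`isOpen_ne_fun`, `Dense.exists_mem_open`; the tree's `IsUnitary.inner_map_map`,
`ClosedSubrep.orthogonal`, `ClosedSubrep.isTopIrreducible_toContRep_iff`. No Mathlib declaration
is duplicated (Mathlib has no matrix coefficients of group representations). The tree's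
`Summit.Langlands…exists_inner_apply_ne_zero` (a Langlands theorem file) is a special-shape
variant (translates of fixed vectors under a subgroup with a centraliser factorisation); the
general statements here do not depend on it.

## Design notes

* DELIBERATE dot-notation extensions in `namespace ContRepresentation` /
  `ContRepresentation.ClosedSubrep`, as in `HilbertRepSpectrum`; nothing else enters a Mathlib
  namespace.
* Provenance. Generic layer of the adjudication package of the 2001 Hodge/CM manuscripts
  (`HodgeCM.RepDecomp`, file `Automorphic/MatrixCoefficients.lean` there, whose consumers are the
  package's "Hecke translates pair inside one constituent" reductions) re-proved over the tree's
  vocabulary so that those problem-specific files can import the tree; nothing here is a claim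
  of those manuscripts.

## References

* A. Deitmar, S. Echterhoff, *Principles of Harmonic Analysis*, 2nd ed., Universitext, Springer
  (2014), §6.1 (cyclic vectors; Lemma 6.1.7), PDF p. 175 [DeitmarEchterhoff2014].
* J. Dixmier, *C\*-algebras*, North-Holland (1977), §13.1.5 (topological irreducibility)
  [Dixmier1977].
-/

noncomputable section

open scoped InnerProductSpace
open Topology

namespace ContRepresentation

section Hilbert

variable {G H H' : Type*} [Group G]
  [NormedAddCommGroup H] [InnerProductSpace ℂ H] [CompleteSpace H]
  [NormedAddCommGroup H'] [InnerProductSpace ℂ H']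
  {π : ContRepresentation ℂ G H}

/-! ### Orthogonal invariant pieces never pair -/

omit [CompleteSpace H] in
/-- **Two orthogonal pieces never pair**: if `u` lies in a closed subrepresentation `W` and
`u' ∈ Wᗮ`, every matrix coefficient `⟪π g u, u'⟫` vanishes. [folklore] -/
theorem ClosedSubrep.inner_apply_eq_zero_of_mem_orthogonal (W : ClosedSubrep π) {u u' : H}
    (hu : u ∈ W) (hu' : u' ∈ W.toSubmoduleᗮ) (g : G) : ⟪π g u, u'⟫_ℂ = 0 :=
  Submodule.inner_right_of_mem_orthogonal (K := W.toSubmodule) (W.apply_mem g hu) hu'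

/-- Mirror form for unitary `π`: `u ∈ Wᗮ`, `u' ∈ W` (`Wᗮ` is then invariant,
`ClosedSubrep.orthogonal`). [folklore] -/
theorem ClosedSubrep.inner_apply_eq_zero_of_mem_orthogonal' (hπ : π.IsUnitary) (W : ClosedSubrep π)
    {u u' : H} (hu : u ∈ W.toSubmoduleᗮ) (hu' : u' ∈ W) (g : G) : ⟪π g u, u'⟫_ℂ = 0 := by
  have h : π g u ∈ W.orthogonal hπ := (W.orthogonal hπ).apply_mem g hu
  exact Submodule.inner_left_of_mem_orthogonal (K := W.toSubmodule) hu' h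

/-! ### The annihilator of the coefficients against a fixed vector -/

variable (π) in
omit [CompleteSpace H] in
/-- The vectors all of whose translates are orthogonal to `u'`: `{v | ∀ g, ⟪π g v, u'⟫ = 0}`, a
closed subrepresentation (an intersection of closed hyperplanes, stable under `π h` because
`π g (π h v) = π (g h) v`). [folklore] -/
def ClosedSubrep.coefficientAnnihilator (u' : H) : ClosedSubrep π where
  toSubmodule :=
    { carrier := {v : H | ∀ g : G, ⟪π g v, u'⟫_ℂ = 0}
      add_mem' := fun {a b} ha hb g => by
        simp only [Set.mem_setOf_eq] at ha hb ⊢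
        rw [map_add, inner_add_left, ha g, hb g, add_zero]
      zero_mem' := fun g => by simp
      smul_mem' := fun c v hv g => by
        simp only [Set.mem_setOf_eq] at hv ⊢
        rw [map_smul, inner_smul_left, hv g, mul_zero] }
  apply_mem_toSubmodule h v hv g := by
    change ⟪π g (π h v), u'⟫_ℂ = 0
    rw [← mul_apply_eq_comp, ← map_mul]
    exact hv (g * h)
  isClosed' := by
    have h : ({v : H | ∀ g : G, ⟪π g v, u'⟫_ℂ = 0} : Set H) = ⋂ g : G, {v | ⟪π g v, u'⟫_ℂ = 0} := by
      ext v
      simp only [Set.mem_setOf_eq, Set.mem_iInter]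
    change IsClosed ({v : H | ∀ g : G, ⟪π g v, u'⟫_ℂ = 0} : Set H)
    rw [h]
    exact isClosed_iInter fun g =>
      isClosed_eq ((π g).continuous.inner continuous_const) continuous_const

omit [CompleteSpace H] in
/-- Membership in the coefficient annihilator (definitional). [folklore] -/
theorem ClosedSubrep.mem_coefficientAnnihilator_iff {u' v : H} :
    v ∈ ClosedSubrep.coefficientAnnihilator π u' ↔ ∀ g : G, ⟪π g v, u'⟫_ℂ = 0 :=
  Iff.rfl

omit [CompleteSpace H] in
/-- A vector in its own coefficient annihilator is zero (`g = 1`). [folklore] -/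
theorem ClosedSubrep.eq_zero_of_mem_coefficientAnnihilator_self {u' : H}
    (h : u' ∈ ClosedSubrep.coefficientAnnihilator π u') : u' = 0 := by
  have h1 := h 1
  rw [map_one, one_apply_eq_self] at h1
  exact inner_self_eq_zero.mp h1

/-! ### Coefficients of an irreducible closed subrepresentation -/

omit [CompleteSpace H] in
/-- **Matrix coefficients of a topologically irreducible closed subrepresentation do not vanish
identically**: for non-zero `u, u' ∈ W` some `⟪π g u, u'⟫ ≠ 0`. Otherwise the closed
subrepresentation `W ∩ {v | ∀ g, ⟪π g v, u'⟫ = 0}` contains `u ≠ 0`, hence equals `W`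
(`ClosedSubrep.isTopIrreducible_toContRep_iff`), so `u'` annihilates itself
(Deitmar–Echterhoff (2014), §6.1: every non-zero vector of an irreducible representation is
cyclic). [cite: DeitmarEchterhoff2014, §6.1 (cyclic vectors, before Lemma 6.1.7)] -/
theorem ClosedSubrep.exists_inner_apply_ne_zero (W : ClosedSubrep π)
    (hW : W.toContRep.IsTopIrreducible) {u u' : H} (hu : u ∈ W) (hu0 : u ≠ 0) (hu' : u' ∈ W)
    (hu'0 : u' ≠ 0) : ∃ g : G, ⟪π g u, u'⟫_ℂ ≠ 0 := by
  by_contra hall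
  push Not at hall
  -- the closed subrepresentation `U = W ∩ Ann(u')`
  let U : ClosedSubrep π :=
    { toSubmodule := W.toSubmodule ⊓ (ClosedSubrep.coefficientAnnihilator π u').toSubmodule
      apply_mem_toSubmodule := fun g v hv =>
        ⟨W.apply_mem g hv.1, (ClosedSubrep.coefficientAnnihilator π u').apply_mem g hv.2⟩
      isClosed' := by
        rw [Submodule.coe_inf]
        exact W.isClosed.inter (ClosedSubrep.coefficientAnnihilator π u').isClosed }
  have hUle : U ≤ W := fun v hv => hv.1
  have huU : u ∈ U := ⟨hu, hall⟩
  rcases ((ClosedSubrep.isTopIrreducible_toContRep_iff W).mp hW).2 U hUle with h0 | h1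
  · apply hu0
    have : u ∈ (⊥ : ClosedSubrep π) := h0 ▸ huU
    exact (ClosedSubrep.mem_bot).mp this
  · have hu'U : u' ∈ U := h1.symm ▸ hu'
    exact hu'0 (ClosedSubrep.eq_zero_of_mem_coefficientAnnihilator_self hu'U.2)

omit [CompleteSpace H] in
/-- For an irreducible `π` itself: non-zero `u, u'` pair under some translate.
[cite: DeitmarEchterhoff2014, §6.1 (cyclic vectors, before Lemma 6.1.7)] -/
theorem IsTopIrreducible.exists_inner_apply_ne_zero (hπ : π.IsTopIrreducible) {u u' : H}
    (hu0 : u ≠ 0) (hu'0 : u' ≠ 0) : ∃ g : G, ⟪π g u, u'⟫_ℂ ≠ 0 := by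
  have htop : (⊤ : ClosedSubrep π).toContRep.IsTopIrreducible := by
    rw [ClosedSubrep.isTopIrreducible_toContRep_iff]
    refine ⟨?_, fun W' _ => ?_⟩
    · intro h
      have hu : u ∈ (⊤ : ClosedSubrep π) := ClosedSubrep.mem_top u
      rw [h, ClosedSubrep.mem_bot] at hu
      exact hu0 hu
    · haveI : IsSimpleOrder (ClosedSubrep π) := hπ
      exact IsSimpleOrder.eq_bot_or_eq_top W'
  exact ClosedSubrep.exists_inner_apply_ne_zero ⊤ htop (ClosedSubrep.mem_top u) hu0
    (ClosedSubrep.mem_top u') hu'0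

/-! ### Unitary complements: two-sided coefficients, stabilisers, double cosets -/

/-- `⟪π g u, π g' u'⟫ = ⟪π (g'⁻¹ g) u, u'⟫` for unitary `π`. [folklore] -/
theorem IsUnitary.inner_apply_apply (hπ : π.IsUnitary) (u u' : H) (g g' : G) :
    ⟪π g u, π g' u'⟫_ℂ = ⟪π (g'⁻¹ * g) u, u'⟫_ℂ := by
  conv_lhs => rw [show g = g' * (g'⁻¹ * g) by group, map_mul, mul_apply_eq_comp]
  exact hπ.inner_map_map g' _ _

/-- Two-sided form for unitary `π`: for non-zero `u, u'` in an irreducible closed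
subrepresentation and any `g'`, some `⟪π g u, π g' u'⟫ ≠ 0`.
[cite: DeitmarEchterhoff2014, §6.1 (cyclic vectors, before Lemma 6.1.7)] -/
theorem ClosedSubrep.exists_inner_apply_apply_ne_zero (hπ : π.IsUnitary) (W : ClosedSubrep π)
    (hW : W.toContRep.IsTopIrreducible) {u u' : H} (hu : u ∈ W) (hu0 : u ≠ 0) (hu' : u' ∈ W)
    (hu'0 : u' ≠ 0) (g' : G) : ∃ g : G, ⟪π g u, π g' u'⟫_ℂ ≠ 0 := by
  refine W.exists_inner_apply_ne_zero hW hu hu0 (W.apply_mem g' hu') ?_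
  intro h0
  apply hu'0
  have h := hπ.norm_map g' u'
  rw [h0, norm_zero] at h
  exact norm_eq_zero.mp h.symm

omit [CompleteSpace H] in
/-- Right invariance under the stabiliser of `u`: `⟪π (g k) u, u'⟫ = ⟪π g u, u'⟫` if `π k u = u`.
[folklore] -/
theorem inner_apply_mul_right_of_apply_eq {u : H} {k : G} (hk : π k u = u) (g : G) (u' : H) :
    ⟪π (g * k) u, u'⟫_ℂ = ⟪π g u, u'⟫_ℂ := by
  rw [map_mul, mul_apply_eq_comp, hk]

/-- Left invariance under the stabiliser of `u'`, for unitary `π`: `⟪π (k' g) u, u'⟫ = ⟪π g u, u'⟫`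
if `π k' u' = u'`. [folklore] -/
theorem IsUnitary.inner_apply_mul_left_of_apply_eq (hπ : π.IsUnitary) {u' : H} {k' : G}
    (hk' : π k' u' = u') (g : G) (u : H) : ⟪π (k' * g) u, u'⟫_ℂ = ⟪π g u, u'⟫_ℂ := by
  conv_lhs => rw [← hk', map_mul, mul_apply_eq_comp]
  exact hπ.inner_map_map k' _ _

/-- The coefficient is constant on double cosets `Stab(u') g Stab(u)` (unitary `π`). [folklore] -/
theorem IsUnitary.inner_apply_doubleCoset_eq (hπ : π.IsUnitary) {u u' : H} {k k' : G}
    (hk : π k u = u) (hk' : π k' u' = u') (g : G) :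
    ⟪π (k' * g * k) u, u'⟫_ℂ = ⟪π g u, u'⟫_ℂ := by
  rw [inner_apply_mul_right_of_apply_eq hk, hπ.inner_apply_mul_left_of_apply_eq hk']

/-! ### Where the non-vanishing translate can be taken -/

omit [CompleteSpace H] in
/-- The set of `g` with `⟪π g u, u'⟫ ≠ 0` is open when the orbit map of `u` is continuous.
[folklore] -/
theorem isOpen_setOf_inner_apply_ne_zero [TopologicalSpace G] {u : H}
    (hc : Continuous fun g : G => π g u) (u' : H) : IsOpen {g : G | ⟪π g u, u'⟫_ℂ ≠ 0} :=
  isOpen_ne_fun (hc.inner continuous_const) continuous_const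

omit [CompleteSpace H] in
/-- **A dense subset already pairs**: if the orbit map of `u` is continuous (e.g. `π` strongly
continuous) and `Λ ⊆ G` is dense, then for non-zero `u, u'` in an irreducible closed
subrepresentation some `γ ∈ Λ` has `⟪π γ u, u'⟫ ≠ 0`.
[cite: DeitmarEchterhoff2014, §6.1 (cyclic vectors, before Lemma 6.1.7)] -/
theorem ClosedSubrep.exists_mem_inner_apply_ne_zero_of_dense [TopologicalSpace G] {Λ : Set G}
    (hΛ : Dense Λ) (W : ClosedSubrep π) (hW : W.toContRep.IsTopIrreducible) {u u' : H}
    (hc : Continuous fun g : G => π g u) (hu : u ∈ W) (hu0 : u ≠ 0) (hu' : u' ∈ W)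
    (hu'0 : u' ≠ 0) : ∃ γ ∈ Λ, ⟪π γ u, u'⟫_ℂ ≠ 0 :=
  hΛ.exists_mem_open (isOpen_setOf_inner_apply_ne_zero hc u')
    (W.exists_inner_apply_ne_zero hW hu hu0 hu' hu'0)

omit [CompleteSpace H] in
/-- **Coset representatives already pair** (no topology): if every `g` factors as `γ k` with
`γ ∈ Λ` and `π k u = u` (`G = Λ · Stab(u)`), some `γ ∈ Λ` has `⟪π γ u, u'⟫ ≠ 0`.
[cite: DeitmarEchterhoff2014, §6.1 (cyclic vectors, before Lemma 6.1.7)] -/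
theorem ClosedSubrep.exists_mem_inner_apply_ne_zero_of_coset {Λ : Set G} {u : H}
    (hcov : ∀ g : G, ∃ γ ∈ Λ, ∃ k : G, π k u = u ∧ g = γ * k) (W : ClosedSubrep π)
    (hW : W.toContRep.IsTopIrreducible) {u' : H} (hu : u ∈ W) (hu0 : u ≠ 0) (hu' : u' ∈ W)
    (hu'0 : u' ≠ 0) : ∃ γ ∈ Λ, ⟪π γ u, u'⟫_ℂ ≠ 0 := by
  obtain ⟨g, hg⟩ := W.exists_inner_apply_ne_zero hW hu hu0 hu' hu'0
  obtain ⟨γ, hγ, k, hk, rfl⟩ := hcov g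
  exact ⟨γ, hγ, by rwa [inner_apply_mul_right_of_apply_eq hk] at hg⟩

/-- **Double-coset representatives already pair** (unitary `π`, no topology): if every `g`
factors as `k' γ k` with `γ ∈ Λ`, `π k u = u` and `π k' u' = u'`
(`G = Stab(u') · Λ · Stab(u)`), some `γ ∈ Λ` has `⟪π γ u, u'⟫ ≠ 0`.
[cite: DeitmarEchterhoff2014, §6.1 (cyclic vectors, before Lemma 6.1.7)] -/
theorem ClosedSubrep.exists_mem_inner_apply_ne_zero_of_doubleCoset (hπ : π.IsUnitary) {Λ : Set G}
    {u u' : H}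
    (hcov : ∀ g : G, ∃ k' : G, ∃ γ ∈ Λ, ∃ k : G, π k u = u ∧ π k' u' = u' ∧ g = k' * γ * k)
    (W : ClosedSubrep π) (hW : W.toContRep.IsTopIrreducible) (hu : u ∈ W) (hu0 : u ≠ 0)
    (hu' : u' ∈ W) (hu'0 : u' ≠ 0) : ∃ γ ∈ Λ, ⟪π γ u, u'⟫_ℂ ≠ 0 := by
  obtain ⟨g, hg⟩ := W.exists_inner_apply_ne_zero hW hu hu0 hu' hu'0
  obtain ⟨k', γ, hγ, k, hk, hk', rfl⟩ := hcov g
  exact ⟨γ, hγ, by rwa [hπ.inner_apply_doubleCoset_eq hk hk'] at hg⟩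

/-! ### The multiplicity-one packaging -/

omit [CompleteSpace H] in
/-- **If the `σ`-isotypic component is itself irreducible** (multiplicity one for the class of
`σ`), any two non-zero vectors of it pair under some translate. At multiplicity `≥ 2` this
fails: two orthogonal members carry non-zero vectors that never pair
(`ClosedSubrep.inner_apply_eq_zero_of_mem_orthogonal`).
[cite: DeitmarEchterhoff2014, §6.1 (cyclic vectors, before Lemma 6.1.7)] -/
theorem exists_inner_apply_ne_zero_of_isTopIrreducible_isotypicComponent
    {σ : ContRepresentation ℂ G H'} (hσ : (π.isotypicComponent σ).toContRep.IsTopIrreducible)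
    {u u' : H} (hu : u ∈ π.isotypicComponent σ) (hu0 : u ≠ 0) (hu' : u' ∈ π.isotypicComponent σ)
    (hu'0 : u' ≠ 0) : ∃ g : G, ⟪π g u, u'⟫_ℂ ≠ 0 :=
  (π.isotypicComponent σ).exists_inner_apply_ne_zero hσ hu hu0 hu' hu'0

end Hilbert

end ContRepresentation

end
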